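import Literature.Algebra.Homology.FreeAbelianRankTwoCohomology
import Literature.Algebra.Homology.InfiniteCyclicQuotientCohomology
import Literature.LinearAlgebra.ScalarFiltration
import Mathlib.RepresentationTheory.Homological.GroupCohomology.LowDegree
import Mathlib.RepresentationTheory.Homological.GroupCohomology.Functoriality
import Mathlib.LinearAlgebra.FiniteDimensional.Basic
import HarnessLib

/-!
# Eigencharacters of endomorphisms of a rank-two free abelian group on its cohomology

Topic `Algebra/Homology`; namespace `Literature.Algebra.Homology`.  Theorems (and two auxiliary
definitions with bodies); no named fact.

Let `Λ` be free abelian of rank `2` (written multiplicatively: commutative, generated by `b₁, b₂`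
with no relation, as in `FreeAbelianRankTwoCohomology`), `k` a field with the trivial action, and
`c : X → (Λ →* Λ)` a family of endomorphisms with two common "eigen-coordinates": additive
characters `θ₁, θ₂ : Λ → k`, not proportional, with `θᵢ (c x λ) = eᵢ x · θᵢ λ`.  The pair maps
`Φₓ = Hⁿ(c x, id)` on `Hⁿ(Λ, k)` then have a stable filtration of scalar type
(`Literature.LinearAlgebra.ScalarFiltered`) with the following characters:

* `H⁰`: `1` (`scalarFiltered_H0`);
* `H¹ ≅ Hom(Λ, k) = k θ₁ ⊕ k θ₂`: `e₁, e₂` (`scalarFiltered_H1`);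
* `H² = k · [θ₁ ∪ θ₂]`: `e₁ e₂` (`scalarFiltered_H2`; `dim H² ≤ 1` by the Wang sequence of
  `InfiniteCyclicQuotientCohomology`, `[θ₁ ∪ θ₂] ≠ 0` by antisymmetrisation);
* `Hⁿ = 0`, `n ≥ 3` (`scalarFiltered_of_three_le`).

This is the `ℤ²`-case of the torus weights on the cohomology of the unipotent radical of a Borel
subgroup (for a lattice `Λ ⊂ F` in an imaginary quadratic field and `c x =` multiplication by `x`,
`θᵢ = τᵢ|_Λ` for the two complex embeddings and `eᵢ = τᵢ`). [cite: Harder1987, §2]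

## References

* G. Harder, *Eisenstein cohomology of arithmetic groups. The case GL₂*, Invent. Math. 89 (1987), §2.
  [Harder1987]
* K. S. Brown, *Cohomology of Groups*, GTM 87 (1982), III §1, V §6. [Brown1982CohomologyGroups]
-/

noncomputable section

open CategoryTheory CategoryTheory.Limits groupCohomology Literature.LinearAlgebra

universe u

/-! ### Scaling a scalar-filtered family by a character -/

namespace Literature.LinearAlgebra.ScalarFiltered

variable {k : Type*} [Field k] {V : Type*} [AddCommGroup V] [Module k V] {X : Type*}
  {T : X → Module.End k V} {S : Set (X → k)}

/-- **Twisting by a character**: if `T` is scalar-filtered with characters `S` then `x ↦ a x • T x`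
is scalar-filtered with characters `a · S`. [folklore] -/
theorem smul_family (a : X → k) {W : Submodule k V} (h : ScalarFiltered T S W) :
    ScalarFiltered (fun x => a x • T x) ((fun ω => fun x => a x * ω x) '' S) W := by
  induction h with
  | bot => exact bot
  | step hW hle ω hω hact ih =>
    refine step ih hle (fun x => a x * ω x) ⟨ω, hω, rfl⟩ fun x v hv => ?_
    have := Submodule.smul_mem _ (a x) (hact x v hv)
    rwa [smul_sub, smul_smul] at this

end Literature.LinearAlgebra.ScalarFiltered

namespace Literature.Algebra.Homology

variable {k G : Type u} [Field k] [Group G]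

/-! ### The pair maps `Hⁿ(c, id)` on `Hⁿ(Λ, k)` -/

/-- The trivial representation `k` of `G`. [folklore] -/
abbrev trivRep (k G : Type u) [Field k] [Group G] : Rep k G := Rep.trivial k G k

/-- **Multiplication by `a`, `k ∘ c ⟶ k`, as a morphism of pairs over `c : G →* G`.** [folklore] -/
def pairScalar (c : G →* G) (a : k) : Rep.res c (trivRep k G) ⟶ trivRep k G :=
  Rep.ofHom (LinearMap.intertwiningMap_of_isIntertwiningMap _ _ (a • LinearMap.id) fun _ _ => rfl)

/-- Unfolding `pairScalar`. [folklore] -/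
@[simp]
theorem pairScalar_hom_apply (c : G →* G) (a v : k) : (pairScalar (k := k) c a).hom v = a * v := rfl

/-- The identity `k ∘ c ⟶ k` as a morphism of pairs over `c : G →* G`. [folklore] -/
abbrev pairId (c : G →* G) : Rep.res c (trivRep k G) ⟶ trivRep k G := pairScalar c 1

/-- Unfolding `pairId`. [folklore] -/
theorem pairId_hom_apply (c : G →* G) (a : k) : (pairId (k := k) c).hom a = a := by
  rw [pairScalar_hom_apply, one_mul]

/-- **The scaled pair map `Φ_{c,a} = Hⁿ(c, a)`** on `Hⁿ(G, k)`, as a `k`-linear endomorphism.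
[folklore] -/
abbrev pairMapₛ (c : G →* G) (a : k) (n : ℕ) : Module.End k (groupCohomology (trivRep k G) n) :=
  (groupCohomology.map c (pairScalar (k := k) c a) n).hom

/-- **The pair map `Φ_c = Hⁿ(c, id)`** on `Hⁿ(G, k)`, as a `k`-linear endomorphism. [folklore] -/
abbrev pairMap (c : G →* G) (n : ℕ) : Module.End k (groupCohomology (trivRep k G) n) :=
  pairMapₛ c 1 n

/-! ### Degree `0` -/

/-- `Φ_{c,a}` is multiplication by `a` on `H⁰`. [folklore] -/
theorem pairMapₛ_zero_apply (c : G →* G) (a : k) (y : groupCohomology (trivRep k G) 0) :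
    pairMapₛ c a 0 y = a • y := by
  have h := groupCohomology.map_H0Iso_hom_f_apply c (pairScalar (k := k) c a) y
  have hinj : Function.Injective ((H0Iso (trivRep k G)).hom ≫ (shortComplexH0 (trivRep k G)).f).hom := by
    rw [ModuleCat.hom_comp, LinearMap.coe_comp]
    exact (Submodule.injective_subtype _).comp (H0Iso (trivRep k G)).toLinearEquiv.injective
  refine hinj (h.trans ?_)
  rw [map_smul]
  rfl

/-- `Φ_c` is the identity on `H⁰`. [folklore] -/
theorem pairMap_zero_apply (c : G →* G) (y : groupCohomology (trivRep k G) 0) : pairMap c 0 y = y := by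
  rw [pairMap, pairMapₛ_zero_apply, one_smul]

/-- **`H⁰`: scalar type with character `a`.** [folklore] -/
theorem scalarFiltered_H0ₛ {X : Type*} (c : X → (G →* G)) (a : X → k) :
    ScalarFiltered (fun x => pairMapₛ (k := k) (c x) (a x) 0) {a} ⊤ :=
  ScalarFiltered.of_scalar a (Set.mem_singleton _) ⊤ fun x v _ => pairMapₛ_zero_apply (c x) (a x) v

/-- **`H⁰`: scalar type with character `1`.** [folklore] -/
theorem scalarFiltered_H0 {X : Type*} (c : X → (G →* G)) :
    ScalarFiltered (fun x => pairMap (k := k) (c x) 0) {fun _ => (1 : k)} ⊤ :=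
  scalarFiltered_H0ₛ c fun _ => 1

/-! ### Degree `1`: `H¹(G, k) ≅ Hom(G, k)` -/

/-- Precomposition with `c` on additive characters. [folklore] -/
def precompHom (c : G →* G) : (Additive G →+ k) →ₗ[k] (Additive G →+ k) where
  toFun θ := θ.comp (MonoidHom.toAdditive c)
  map_add' _ _ := rfl
  map_smul' _ _ := rfl

/-- Unfolding `precompHom`. [folklore] -/
@[simp]
theorem precompHom_apply (c : G →* G) (θ : Additive G →+ k) (g : G) :
    precompHom (k := k) c θ (Additive.ofMul g) = θ (Additive.ofMul (c g)) := rfl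

/-- **`H¹(G, k) ≅ Hom(G, k)` intertwines `Φ_{c,a}` with `a ·` precomposition by `c`.** [folklore] -/
theorem H1IsoOfIsTrivial_pairMapₛ (c : G →* G) (a : k) (y : groupCohomology (trivRep k G) 1) :
    (H1IsoOfIsTrivial (trivRep k G)).hom (pairMapₛ c a 1 y) =
      a • precompHom c ((H1IsoOfIsTrivial (trivRep k G)).hom y) := by
  obtain ⟨f, rfl⟩ := (ModuleCat.epi_iff_surjective (H1π (trivRep k G))).1 inferInstance y
  refine AddMonoidHom.ext fun g => ?_
  change (H1IsoOfIsTrivial (trivRep k G)).hom ((H1π _ ≫ groupCohomology.map c (pairScalar c a) 1) f) g = _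
  rw [H1π_comp_map]
  change (H1IsoOfIsTrivial (trivRep k G)).hom (H1π _ (mapCocycles₁ c (pairScalar c a) f)) g =
    a * (H1IsoOfIsTrivial (trivRep k G)).hom (H1π _ f) (Additive.ofMul (c g.toMul))
  rw [H1IsoOfIsTrivial_H1π_apply_apply, H1IsoOfIsTrivial_H1π_apply_apply]
  rfl

/-- **`H¹(G, k) ≅ Hom(G, k)` intertwines `Φ_c` with precomposition by `c`.** [folklore] -/
theorem H1IsoOfIsTrivial_pairMap (c : G →* G) (y : groupCohomology (trivRep k G) 1) :
    (H1IsoOfIsTrivial (trivRep k G)).hom (pairMap c 1 y) =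
      precompHom c ((H1IsoOfIsTrivial (trivRep k G)).hom y) := by
  rw [pairMap, H1IsoOfIsTrivial_pairMapₛ, one_smul]

section RankTwo

variable (b₁ b₂ : G) (hcomm : ∀ a b : G, a * b = b * a)
  (hgen : ∀ g : G, ∃ m₁ m₂ : ℤ, g = b₁ ^ m₁ * b₂ ^ m₂)
  (hind : ∀ m₁ m₂ : ℤ, b₁ ^ m₁ * b₂ ^ m₂ = 1 → m₁ = 0 ∧ m₂ = 0)
  (θ₁ θ₂ : Additive G →+ k)
  (hindep : ∀ a b : k, (∀ g : G, a * θ₁ (Additive.ofMul g) + b * θ₂ (Additive.ofMul g) = 0) → a = 0 ∧ b = 0)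

include hgen in
/-- Additive characters agreeing on the generators agree. [folklore] -/
theorem addMonoidHom_ext_of_generators {θ θ' : Additive G →+ k} (h₁ : θ (Additive.ofMul b₁) = θ' (Additive.ofMul b₁))
    (h₂ : θ (Additive.ofMul b₂) = θ' (Additive.ofMul b₂)) : θ = θ' := by
  refine AddMonoidHom.ext fun g => ?_
  obtain ⟨m₁, m₂, hg⟩ := hgen g.toMul
  have : g = m₁ • Additive.ofMul b₁ + m₂ • Additive.ofMul b₂ := by
    rw [← ofMul_zpow, ← ofMul_zpow, ← ofMul_mul, ← hg, ofMul_toMul]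
  rw [this, map_add, map_add, map_zsmul, map_zsmul, map_zsmul, map_zsmul, h₁, h₂]

include hgen hindep in
/-- The "determinant" `θ₁(b₁) θ₂(b₂) - θ₁(b₂) θ₂(b₁)` of two non-proportional characters is non-zero.
[folklore] -/
theorem det_ne_zero :
    θ₁ (Additive.ofMul b₁) * θ₂ (Additive.ofMul b₂) - θ₁ (Additive.ofMul b₂) * θ₂ (Additive.ofMul b₁) ≠ 0 := by
  intro hD
  -- a dependence `a θ₁ + b θ₂ = 0` read off the generators
  have key : ∀ a b : k, a * θ₁ (Additive.ofMul b₁) + b * θ₂ (Additive.ofMul b₁) = 0 →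
      a * θ₁ (Additive.ofMul b₂) + b * θ₂ (Additive.ofMul b₂) = 0 → a = 0 ∧ b = 0 := by
    intro a b ha hb
    refine hindep a b fun g => ?_
    have hθ : (a • θ₁ + b • θ₂) = 0 := by
      refine addMonoidHom_ext_of_generators b₁ b₂ hgen ?_ ?_
      · simpa using ha
      · simpa using hb
    have := DFunLike.congr_fun hθ (Additive.ofMul g)
    simpa using this
  -- first candidate: `(θ₂ b₁, -θ₁ b₁)`
  have h1 := key (θ₂ (Additive.ofMul b₁)) (-θ₁ (Additive.ofMul b₁)) (by ring)
    (by linear_combination -hD)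
  -- so `θ₁ b₁ = θ₂ b₁ = 0`; second candidate `(θ₂ b₂, -θ₁ b₂)`
  have h2 := key (θ₂ (Additive.ofMul b₂)) (-θ₁ (Additive.ofMul b₂))
    (by rw [h1.1, neg_eq_zero.1 h1.2]; ring) (by ring)
  -- now `θ₁` vanishes on both generators: `θ₁ = 0`, contradicting independence with `(1, 0)`
  have h3 := hindep 1 0 fun g => by
    have hθ : θ₁ = 0 := addMonoidHom_ext_of_generators b₁ b₂ hgen
      (by rw [neg_eq_zero.1 h1.2, AddMonoidHom.zero_apply]) (by rw [neg_eq_zero.1 h2.2, AddMonoidHom.zero_apply])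
    rw [hθ, AddMonoidHom.zero_apply, mul_zero, zero_mul, add_zero]
  exact one_ne_zero h3.1

include hgen hindep in
/-- **`Hom(G, k) = k θ₁ ⊕ k θ₂`**: every additive character is a combination of `θ₁, θ₂`. [folklore] -/
theorem exists_eq_smul_add_smul (θ : Additive G →+ k) : ∃ a b : k, θ = a • θ₁ + b • θ₂ := by
  set D := θ₁ (Additive.ofMul b₁) * θ₂ (Additive.ofMul b₂) - θ₁ (Additive.ofMul b₂) * θ₂ (Additive.ofMul b₁) with hDdef
  have hD : D ≠ 0 := det_ne_zero b₁ b₂ hgen θ₁ θ₂ hindep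
  refine ⟨(θ (Additive.ofMul b₁) * θ₂ (Additive.ofMul b₂) - θ (Additive.ofMul b₂) * θ₂ (Additive.ofMul b₁)) / D,
    (θ₁ (Additive.ofMul b₁) * θ (Additive.ofMul b₂) - θ₁ (Additive.ofMul b₂) * θ (Additive.ofMul b₁)) / D, ?_⟩
  refine addMonoidHom_ext_of_generators b₁ b₂ hgen ?_ ?_
  · simp only [AddMonoidHom.add_apply, AddMonoidHom.smul_apply, smul_eq_mul]
    field_simp
    rw [hDdef]; ring
  · simp only [AddMonoidHom.add_apply, AddMonoidHom.smul_apply, smul_eq_mul]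
    field_simp
    rw [hDdef]; ring

variable {X : Type*} (c : X → (G →* G)) (e₁ e₂ : X → k)
  (he₁ : ∀ x g, θ₁ (Additive.ofMul (c x g)) = e₁ x * θ₁ (Additive.ofMul g))
  (he₂ : ∀ x g, θ₂ (Additive.ofMul (c x g)) = e₂ x * θ₂ (Additive.ofMul g))

include hgen hindep he₁ he₂ in
/-- `Hom(G, k)` with precomposition by `c` is scalar-filtered with characters `e₁, e₂`. [folklore] -/
theorem scalarFiltered_precompHom :
    ScalarFiltered (fun x => precompHom (k := k) (c x)) {e₁, e₂} ⊤ := by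
  have hθ₁ : ∀ x, precompHom (k := k) (c x) θ₁ = e₁ x • θ₁ := fun x =>
    AddMonoidHom.ext fun g => by
      rw [AddMonoidHom.smul_apply, smul_eq_mul]
      exact he₁ x g.toMul
  have hθ₂ : ∀ x, precompHom (k := k) (c x) θ₂ = e₂ x • θ₂ := fun x =>
    AddMonoidHom.ext fun g => by
      rw [AddMonoidHom.smul_apply, smul_eq_mul]
      exact he₂ x g.toMul
  -- `⊥ ≤ k θ₁ ≤ ⊤`
  have h1 : ScalarFiltered (fun x => precompHom (k := k) (c x)) {e₁, e₂} (k ∙ θ₁) :=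
    ScalarFiltered.of_scalar e₁ (Set.mem_insert _ _) _ fun x v hv => by
      obtain ⟨a, rfl⟩ := Submodule.mem_span_singleton.1 hv
      rw [map_smul, hθ₁, smul_comm]
  refine ScalarFiltered.step h1 le_top e₂ (Set.mem_insert_of_mem _ rfl) fun x θ _ => ?_
  obtain ⟨a, b, rfl⟩ := exists_eq_smul_add_smul b₁ b₂ hgen θ₁ θ₂ hindep θ
  rw [map_add, map_smul, map_smul, hθ₁, hθ₂, smul_add, smul_smul, smul_smul, smul_smul, smul_smul,
    mul_comm (e₂ x) b, add_sub_add_right_eq_sub, ← sub_smul]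
  exact Submodule.smul_mem _ _ (Submodule.mem_span_singleton_self _)

include hgen hindep he₁ he₂ in
/-- **`H¹(G, k)`: scalar type with characters `a e₁, a e₂`** for the scaled pair maps. [cite: Harder1987, §2] -/
theorem scalarFiltered_H1ₛ (a : X → k) :
    ScalarFiltered (fun x => pairMapₛ (k := k) (c x) (a x) 1) {fun x => a x * e₁ x, fun x => a x * e₂ x} ⊤ := by
  have h := (scalarFiltered_precompHom b₁ b₂ hgen θ₁ θ₂ hindep c e₁ e₂ he₁ he₂).smul_family a
  rw [Set.image_insert_eq, Set.image_singleton] at h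
  exact ScalarFiltered.of_injective (T' := fun x => a x • precompHom (k := k) (c x))
    (H1IsoOfIsTrivial (trivRep k G)).toLinearEquiv.toLinearMap
    (H1IsoOfIsTrivial (trivRep k G)).toLinearEquiv.injective
    (fun x v => H1IsoOfIsTrivial_pairMapₛ (c x) (a x) v) h

include hgen hindep he₁ he₂ in
/-- **`H¹(G, k)`: scalar type with characters `e₁, e₂`.** [cite: Harder1987, §2] -/
theorem scalarFiltered_H1 :
    ScalarFiltered (fun x => pairMap (k := k) (c x) 1) {e₁, e₂} ⊤ := by
  have h := scalarFiltered_H1ₛ b₁ b₂ hgen θ₁ θ₂ hindep c e₁ e₂ he₁ he₂ fun _ => 1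
  simp only [one_mul] at h
  exact h

/-! ### Degree `2`: the cup product class `[θ₁ ∪ θ₂]` -/

/-- **The cup-product `2`-cocycle `(g, h) ↦ θ₁(g) θ₂(h)`** (trivial coefficients). [folklore] -/
def cupCocycle : cocycles₂ (trivRep k G) :=
  ⟨fun p => θ₁ (Additive.ofMul p.1) * θ₂ (Additive.ofMul p.2), by
    rw [mem_cocycles₂_iff]
    intro g h j
    change θ₁ (Additive.ofMul (g * h)) * θ₂ (Additive.ofMul j) + θ₁ (Additive.ofMul g) * θ₂ (Additive.ofMul h) =
      θ₁ (Additive.ofMul h) * θ₂ (Additive.ofMul j) + θ₁ (Additive.ofMul g) * θ₂ (Additive.ofMul (h * j))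
    rw [ofMul_mul, ofMul_mul, map_add, map_add]
    ring⟩

/-- Values of `cupCocycle`. [folklore] -/
@[simp]
theorem cupCocycle_apply (g h : G) :
    cupCocycle (k := k) θ₁ θ₂ (g, h) = θ₁ (Additive.ofMul g) * θ₂ (Additive.ofMul h) := rfl

include he₁ he₂ in
/-- `Φ_{c,a}` multiplies the cup cocycle by `a e₁ e₂`. [folklore] -/
theorem mapCocycles₂_cupCocycle (x : X) (a : k) :
    mapCocycles₂ (c x) (pairScalar (k := k) (c x) a) (cupCocycle θ₁ θ₂) =
      (a * (e₁ x * e₂ x)) • cupCocycle θ₁ θ₂ := by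
  refine cocycles₂_ext fun g h => ?_
  rw [coe_mapCocycles₂]
  change a * (θ₁ (Additive.ofMul (c x g)) * θ₂ (Additive.ofMul (c x h))) =
    (a * (e₁ x * e₂ x)) * (θ₁ (Additive.ofMul g) * θ₂ (Additive.ofMul h))
  rw [he₁, he₂]
  ring

include he₁ he₂ in
/-- `Φ_{c,a} [θ₁ ∪ θ₂] = a e₁ e₂ [θ₁ ∪ θ₂]`. [folklore] -/
theorem pairMapₛ_two_cupClass (x : X) (a : k) :
    pairMapₛ (c x) a 2 (H2π (trivRep k G) (cupCocycle θ₁ θ₂)) =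
      (a * (e₁ x * e₂ x)) • H2π (trivRep k G) (cupCocycle θ₁ θ₂) := by
  change (H2π _ ≫ groupCohomology.map (c x) (pairScalar (c x) a) 2) (cupCocycle θ₁ θ₂) = _
  rw [H2π_comp_map]
  change H2π _ (mapCocycles₂ (c x) (pairScalar (c x) a) (cupCocycle θ₁ θ₂)) = _
  rw [mapCocycles₂_cupCocycle θ₁ θ₂ c e₁ e₂ he₁ he₂, map_smul]

include hcomm hgen hindep in
/-- **`[θ₁ ∪ θ₂] ≠ 0`**: a coboundary `δg` is symmetric on commuting pairs, `θ₁ ⊗ θ₂` is not.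
[folklore] -/
theorem cupClass_ne_zero : H2π (trivRep k G) (cupCocycle θ₁ θ₂) ≠ 0 := by
  intro h0
  rw [H2π_eq_zero_iff] at h0
  obtain ⟨g, hg⟩ := h0
  have hval : ∀ a b : G, θ₁ (Additive.ofMul a) * θ₂ (Additive.ofMul b) = g b - g (a * b) + g a := by
    intro a b
    have := congrFun hg (a, b)
    exact this.symm
  have hsymm : θ₁ (Additive.ofMul b₁) * θ₂ (Additive.ofMul b₂) = θ₁ (Additive.ofMul b₂) * θ₂ (Additive.ofMul b₁) := by
    rw [hval, hval, hcomm b₂ b₁]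
    ring
  exact det_ne_zero b₁ b₂ hgen θ₁ θ₂ hindep (sub_eq_zero.2 hsymm)

include hcomm hgen hind in
/-- **`dim H²(G, k) ≤ 1`** and `H²(G, k)` is finite-dimensional (Wang sequence: `H¹(⟨b₁⟩, k) ↠ H²(G, k)`
and `H¹(⟨b₁⟩, k) ↪ k` by evaluation at `b₁`). [cite: Brown1982CohomologyGroups, III §1, V §6] -/
theorem finite_and_finrank_H2_le_one :
    Module.Finite k (groupCohomology (trivRep k G) 2) ∧ Module.finrank k (groupCohomology (trivRep k G) 2) ≤ 1 := by
  haveI := normal_of_comm hcomm (Subgroup.zpowers b₁)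
  set H := Subgroup.zpowers b₁ with hH
  set T := trivRep k G with hT
  have hX := shortExact_shiftComplex H T b₂ (exists_zpowers_mul_zpow b₁ b₂ hgen)
    (eq_zero_of_zpow_mem_zpowers b₁ b₂ hind)
  -- `H²(G, Coind) ≅ H²(H, k) = 0`
  have hz : IsZero (groupCohomology (shiftComplex H T b₂).X₂ 2) :=
    (isZero_groupCohomology_add_two_of_infinite_cyclic (Rep.res H.subtype T) ⟨b₁, Subgroup.mem_zpowers b₁⟩
      (exists_eq_zpow_of_mem_zpowers b₁) (eq_zero_of_zpow_eq_one b₁ b₂ hind) 0).of_iso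
      (groupCohomology.coindIso (Rep.res H.subtype T) 2)
  haveI := groupCohomology.epi_δ_of_isZero hX 1 hz
  have hsurj : Function.Surjective (groupCohomology.δ hX 1 2 rfl).hom :=
    (ModuleCat.epi_iff_surjective _).1 inferInstance
  -- `H¹(G, Coind) ≅ H¹(H, k) ↪ k`
  haveI htriv : (Rep.res H.subtype T).IsTrivial := ⟨fun _ => rfl⟩
  set ev : (Additive H →+ k) →ₗ[k] k :=
    { toFun := fun θ => θ (Additive.ofMul ⟨b₁, Subgroup.mem_zpowers b₁⟩)
      map_add' := fun _ _ => rfl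
      map_smul' := fun _ _ => rfl } with hev
  have hev_inj : Function.Injective ev := by
    intro θ θ' hθ
    refine AddMonoidHom.ext fun h => ?_
    obtain ⟨n, hn⟩ := exists_eq_zpow_of_mem_zpowers b₁ h.toMul
    have : h = n • Additive.ofMul (⟨b₁, Subgroup.mem_zpowers b₁⟩ : H) := by
      rw [← ofMul_zpow, ← hn, ofMul_toMul]
    rw [this, map_zsmul, map_zsmul]
    exact congrArg (n • ·) hθ
  set ψ : groupCohomology (shiftComplex H T b₂).X₃ 1 →ₗ[k] k :=
    ev ∘ₗ (H1IsoOfIsTrivial (Rep.res H.subtype T)).toLinearEquiv.toLinearMap ∘ₗ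
      (groupCohomology.coindIso (Rep.res H.subtype T) 1).toLinearEquiv.toLinearMap with hψ
  have hψ_inj : Function.Injective ψ :=
    hev_inj.comp ((H1IsoOfIsTrivial (Rep.res H.subtype T)).toLinearEquiv.injective.comp
      (groupCohomology.coindIso (Rep.res H.subtype T) 1).toLinearEquiv.injective)
  haveI hfin₃ : Module.Finite k (groupCohomology (shiftComplex H T b₂).X₃ 1) :=
    Module.Finite.of_injective ψ hψ_inj
  have hrank₃ : Module.finrank k (groupCohomology (shiftComplex H T b₂).X₃ 1) ≤ 1 := by
    have := LinearMap.finrank_le_finrank_of_injective hψ_inj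
    rwa [Module.finrank_self] at this
  refine ⟨Module.Finite.of_surjective _ hsurj, ?_⟩
  calc Module.finrank k (groupCohomology T 2)
      = Module.finrank k (LinearMap.range (groupCohomology.δ hX 1 2 rfl).hom) := by
        rw [LinearMap.range_eq_top.2 hsurj, finrank_top]; rfl
    _ ≤ Module.finrank k (groupCohomology (shiftComplex H T b₂).X₃ 1) := LinearMap.finrank_range_le _
    _ ≤ 1 := hrank₃

include hcomm hgen hind hindep in
/-- **`H²(G, k) = k · [θ₁ ∪ θ₂]`.** [cite: Brown1982CohomologyGroups, V §6] -/
theorem exists_smul_cupClass_eq (w : groupCohomology (trivRep k G) 2) :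
    ∃ a : k, a • H2π (trivRep k G) (cupCocycle θ₁ θ₂) = w := by
  obtain ⟨hfin, hle⟩ := finite_and_finrank_H2_le_one (k := k) b₁ b₂ hcomm hgen hind
  haveI := hfin
  have hne := cupClass_ne_zero b₁ b₂ hcomm hgen θ₁ θ₂ hindep
  have hpos : 0 < Module.finrank k (groupCohomology (trivRep k G) 2) :=
    Module.finrank_pos_iff_exists_ne_zero.2 ⟨_, hne⟩
  exact (finrank_eq_one_iff_of_nonzero' _ hne).1 (le_antisymm hle hpos) w

include hcomm hgen hind hindep he₁ he₂ in
/-- **`H²(G, k)`: scalar type with character `a e₁ e₂`** for the scaled pair maps. [cite: Harder1987, §2] -/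
theorem scalarFiltered_H2ₛ (a : X → k) :
    ScalarFiltered (fun x => pairMapₛ (k := k) (c x) (a x) 2) {fun x => a x * (e₁ x * e₂ x)} ⊤ :=
  ScalarFiltered.of_scalar (fun x => a x * (e₁ x * e₂ x)) (Set.mem_singleton _) ⊤ fun x w _ => by
    obtain ⟨b, rfl⟩ := exists_smul_cupClass_eq b₁ b₂ hcomm hgen hind θ₁ θ₂ hindep w
    rw [map_smul, pairMapₛ_two_cupClass θ₁ θ₂ c e₁ e₂ he₁ he₂, smul_comm]

include hcomm hgen hind hindep he₁ he₂ in
/-- **`H²(G, k)`: scalar type with character `e₁ e₂`.** [cite: Harder1987, §2] -/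
theorem scalarFiltered_H2 :
    ScalarFiltered (fun x => pairMap (k := k) (c x) 2) {fun x => e₁ x * e₂ x} ⊤ := by
  have h := scalarFiltered_H2ₛ b₁ b₂ hcomm hgen hind θ₁ θ₂ hindep c e₁ e₂ he₁ he₂ fun _ => 1
  simp only [one_mul] at h
  exact h

/-! ### Degrees `≥ 3` -/

include hcomm hgen hind in
/-- **`Hⁿ(G, k)` for `n ≥ 3` is zero**, hence scalar-filtered for any set of characters (scaled pair
maps). [folklore] -/
theorem scalarFiltered_of_three_leₛ (a : X → k) (S : Set (X → k)) (n : ℕ) :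
    ScalarFiltered (fun x => pairMapₛ (k := k) (c x) (a x) (n + 3)) S ⊤ := by
  have hz := isZero_groupCohomology_of_rankTwo (trivRep k G) b₁ b₂ hcomm hgen hind n
  haveI := ModuleCat.subsingleton_of_isZero hz
  rw [show (⊤ : Submodule k (groupCohomology (trivRep k G) (n + 3))) = ⊥ from Subsingleton.elim _ _]
  exact ScalarFiltered.bot

include hcomm hgen hind in
/-- **`Hⁿ(G, k)` for `n ≥ 3` is zero**, hence scalar-filtered for any set of characters. [folklore] -/
theorem scalarFiltered_of_three_le (S : Set (X → k)) (n : ℕ) :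
    ScalarFiltered (fun x => pairMap (k := k) (c x) (n + 3)) S ⊤ :=
  scalarFiltered_of_three_leₛ b₁ b₂ hcomm hgen hind c (fun _ => 1) S n

end RankTwo

end Literature.Algebra.Homology

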